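import Mathlib
import Summits.CriticalPhenomena.PercolationContinuityZ3.Theorems.PercNonProliferationPolynomialAssembly
import HarnessLib

/-!
# Crux `PercNonProliferation.SubpolynomialBlocking` (stmt-CriticalPhenomena-4446) — the route uses only its FREQUENTLY form

Helper file (lead prover-line-stmt-CriticalPhenomena-4446-c1-0, line `cross-sandwich-flat-seal`), landed
`--supports stmt-CriticalPhenomena-4446`. It records, as kernel-checked theorems, how much of the crux the route
`PercNonProliferation` actually consumes. The crux is filed as

  `∀ s > 0, ∀ᶠ n, n^{-s} ≤ u_n`,  `u_n := P_{p_c(ℤ³)}(Λ_n ↮ ∂ⁱⁿΛ_{2n} inside Λ_{2n})`,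

and is used only through `PolynomialAssembly : MeanCauchySchwarz → SpanningBKCap → FreeBoxPowerSaving →
SubpolynomialBlocking → θ(p_c) = 0`. The assembly's inequality `θ(p_c)² ≤ 64·C·2^{-a}·n^{s-a}` holds AT EVERY SINGLE
SCALE `n ≥ 1` at which `u_n ≥ n^{-s}` (`theta_sq_le_of_blocking`), so `θ(p_c) = 0` already follows from

  (F)  `∃ s < a, ∃ᶠ n, n^{-s} ≤ u_n`   (`a` = the power saving of `FreeBoxPowerSaving`),

i.e. from the blocking bound at ONE exponent below the power saving along ANY subsequence
(`percolationContinuityZ3_of_frequently_blocking`); in particular from the `∃ᶠ` form of the crux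
(`polynomialAssembly_frequently`: `MeanCauchySchwarz → SpanningBKCap → FreeBoxPowerSaving → (∀ s > 0, ∃ᶠ n, n^{-s} ≤ u_n)
→ PercolationContinuityZ3`). The `∀ᶠ` in the filed crux is therefore slack for this route: its negation
`∃ s, ∃ᶠ n, u_n < n^{-s}` (crossing w.h.p. on a SUBSEQUENCE) is what a disproof of the filed crux needs, whereas the route
survives unless `∃ s < a, ∀ᶠ n, u_n < n^{-s}` (crossing w.h.p. at ALL large scales). Message to the planner promoting the
open stubs of this crux: the weakest blocking statement the polynomial pair needs is (F), not the filed `∀ s, ∀ᶠ n` form.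
-/

noncomputable section

namespace Summit.CriticalPhenomena.PercolationContinuityZ3.Theorems.SubpolynomialBlocking

open MeasureTheory Filter Topology
open Literature.Probability.Percolation Literature.Probability.LatticeModels
open Summit.CriticalPhenomena.PercolationContinuityZ3.Theses.PercNonProliferation

namespace FrequentlySuffices

/-- The real arithmetic of the polynomial pair at ONE scale `n ≥ 1`, with a free blocking exponent `s`.  Reading
`θ = θ(p_c)`, `b = |B(n)|`, `b₂ = |B(2n)|`, `EN = E[N_n]`, `ES = E[S_n]`, `T` = the pair sum over `B(2n)`, `u = u_n`:
from `(θ b)² ≤ EN·ES`, `EN ≤ 1/u`, `u ≥ n^{-s}`, `0 ≤ ES ≤ T`, `T/b₂² ≤ C (2n)^{-a}`, `b₂ ≤ 8 b` one gets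
`θ² ≤ 64 C 2^{-a} n^{-(a-s)}`. -/
theorem arith {θ b b₂ EN ES T u C a s : ℝ} {n : ℕ} (hn : 1 ≤ n) (hC : 0 ≤ C)
    (hb : 0 < b) (hb₂ : b₂ ≤ 8 * b) (hb₂0 : 0 < b₂)
    (hMCS : (θ * b) ^ 2 ≤ EN * ES) (hEN : EN ≤ 1 / u) (hu : (n : ℝ) ^ (-s) ≤ u)
    (hES0 : 0 ≤ ES) (hES : ES ≤ T) (hT : T / b₂ ^ 2 ≤ C * ((2 * n : ℕ) : ℝ) ^ (-a)) :
    θ ^ 2 ≤ 64 * C * (2 : ℝ) ^ (-a) * (n : ℝ) ^ (-(a - s)) := by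
  have hn0 : (0 : ℝ) < n := Nat.cast_pos.2 (Nat.succ_le_iff.1 hn)
  have hnpow : 0 < (n : ℝ) ^ (-s) := Real.rpow_pos_of_pos hn0 _
  have hinv : 1 / u ≤ (n : ℝ) ^ s := by
    calc 1 / u ≤ 1 / (n : ℝ) ^ (-s) := one_div_le_one_div_of_le hnpow hu
      _ = (n : ℝ) ^ s := by rw [Real.rpow_neg hn0.le, one_div, inv_inv]
  have h2n : ((2 * n : ℕ) : ℝ) ^ (-a) = (2 : ℝ) ^ (-a) * (n : ℝ) ^ (-a) := by
    rw [Nat.cast_mul, Nat.cast_ofNat]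
    exact Real.mul_rpow (by norm_num) hn0.le
  have hK0 : 0 ≤ C * ((2 : ℝ) ^ (-a) * (n : ℝ) ^ (-a)) :=
    mul_nonneg hC (mul_nonneg (Real.rpow_nonneg (by norm_num) _) (Real.rpow_nonneg hn0.le _))
  have hT' : T ≤ C * ((2 : ℝ) ^ (-a) * (n : ℝ) ^ (-a)) * b₂ ^ 2 := by
    rw [← h2n]
    exact (div_le_iff₀ (pow_pos hb₂0 2)).1 hT
  have hb₂sq : b₂ ^ 2 ≤ 64 * b ^ 2 := by
    calc b₂ ^ 2 ≤ (8 * b) ^ 2 := pow_le_pow_left₀ hb₂0.le hb₂ 2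
      _ = 64 * b ^ 2 := by ring
  have hES' : ES ≤ C * ((2 : ℝ) ^ (-a) * (n : ℝ) ^ (-a)) * (64 * b ^ 2) :=
    hES.trans (hT'.trans (mul_le_mul_of_nonneg_left hb₂sq hK0))
  have hprod : (θ * b) ^ 2 ≤
      (n : ℝ) ^ s * (C * ((2 : ℝ) ^ (-a) * (n : ℝ) ^ (-a)) * (64 * b ^ 2)) :=
    hMCS.trans (mul_le_mul (hEN.trans hinv) hES' hES0 (Real.rpow_nonneg hn0.le _))
  have hcomb : (n : ℝ) ^ s * (n : ℝ) ^ (-a) = (n : ℝ) ^ (-(a - s)) := by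
    rw [← Real.rpow_add hn0]
    congr 1
    ring
  have key : θ ^ 2 * b ^ 2 ≤ 64 * C * (2 : ℝ) ^ (-a) * (n : ℝ) ^ (-(a - s)) * b ^ 2 := by
    calc θ ^ 2 * b ^ 2 = (θ * b) ^ 2 := by ring
      _ ≤ (n : ℝ) ^ s * (C * ((2 : ℝ) ^ (-a) * (n : ℝ) ^ (-a)) * (64 * b ^ 2)) := hprod
      _ = 64 * C * (2 : ℝ) ^ (-a) * ((n : ℝ) ^ s * (n : ℝ) ^ (-a)) * b ^ 2 := by ring
      _ = 64 * C * (2 : ℝ) ^ (-a) * (n : ℝ) ^ (-(a - s)) * b ^ 2 := by rw [hcomb]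
  exact le_of_mul_le_mul_right key (pow_pos hb 2)

end FrequentlySuffices

open FrequentlySuffices

/-- **One scale suffices.** Under `MeanCauchySchwarz` and `SpanningBKCap`, a free-box power saving
`FA₂(m) ≤ C m^{-a}` (`m ≥ 1`) and the blocking bound `u_n ≥ n^{-s}` at a SINGLE scale `n ≥ 1` give
`θ(p_c)² ≤ 64·C·2^{-a}·n^{-(a-s)}` (the inequality inside `PolynomialAssembly`, with the blocking exponent freed). -/
theorem theta_sq_le_of_blocking (hMCS : MeanCauchySchwarz) (hBK : SpanningBKCap) {a C : ℝ}
    (hC : ∀ n : ℕ, 1 ≤ n →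
      (∑ x ∈ box 3 n, ∑ y ∈ box 3 n,
          (bondPercolation (zdGraph 3) (criticalProbI 3)).real (openConnIn ↑(box 3 n) x y)) /
        ((box 3 n).card : ℝ) ^ 2 ≤ C * (n : ℝ) ^ (-a))
    {s : ℝ} {n : ℕ} (hn : 1 ≤ n)
    (hu : (n : ℝ) ^ (-s) ≤ (bondPercolation (zdGraph 3) (criticalProbI 3)).real
      {ω | ¬ ∃ x ∈ box 3 n, ∃ y ∈ innerBoundary (zdGraph 3) (box 3 (2 * n)),
        ω ∈ openConnIn ↑(box 3 (2 * n)) x y}) :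
    (theta (zdGraph 3) (0 : Site 3) (criticalProbI 3)) ^ 2 ≤
      64 * C * (2 : ℝ) ^ (-a) * (n : ℝ) ^ (-(a - s)) := by
  unfold MeanCauchySchwarz at hMCS
  unfold SpanningBKCap at hBK
  have hC0 : 0 ≤ C := by
    have h1 := hC 1 le_rfl
    rw [Nat.cast_one, Real.one_rpow, mul_one] at h1
    exact le_trans (by positivity) h1
  have hn0 : (0 : ℝ) < n := Nat.cast_pos.2 (Nat.succ_le_iff.1 hn)
  have hu0 := (Real.rpow_pos_of_pos hn0 (-s)).trans_le hu
  -- volume doubling: `|B(2n)| = (4n+1)³ ≤ 8 (2n+1)³ = 8 |B(n)|`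
  have h8 : ((box 3 (2 * n)).card : ℝ) ≤ 8 * (box 3 n).card := by
    rw [card_box, card_box]
    have h : (2 * (2 * n) + 1) ^ 3 ≤ 8 * (2 * n + 1) ^ 3 := by
      calc (2 * (2 * n) + 1) ^ 3 ≤ (2 * (2 * n + 1)) ^ 3 := Nat.pow_le_pow_left (by omega) 3
        _ = 8 * (2 * n + 1) ^ 3 := by ring
    exact_mod_cast h
  refine arith hn hC0 ?_ h8 ?_ (hMCS (criticalProbI 3) n) ?_ hu ?_ ?_ (hC (2 * n) (by omega))
  · exact Nat.cast_pos.2 (Finset.card_pos.2 (box_nonempty 3 n))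
  · exact Nat.cast_pos.2 (Finset.card_pos.2 (box_nonempty 3 (2 * n)))
  · refine polynomialAssembly_sum_le_one_div _ ?_ (fun k => hBK (criticalProbI 3) k n) ?_ hu0 _
    · exact polynomialAssembly_measurableSet_exists₂ _ _ fun x _ y _ =>
        DCT16.measurableSet_openConnIn _ x y
    · rfl
  · positivity
  · exact polynomialAssembly_sum_sum_mono (box_mono 3 (by omega)) fun x y => measureReal_nonneg

/-- **The polynomial pair closes the conjunct from a blocking bound at ONE exponent below the power saving, along ANY
subsequence**: `MeanCauchySchwarz`, `SpanningBKCap`, `FA₂(m) ≤ C m^{-a}` (`m ≥ 1`) and `∃ᶠ n, n^{-s} ≤ u_n` for some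
`s < a` give `θ(p_c(ℤ³)) = 0` (`θ² ≤ 64 C 2^{-a} n^{-(a-s)}` frequently, and `n^{-(a-s)} → 0`). -/
theorem percolationContinuityZ3_of_frequently_blocking (hMCS : MeanCauchySchwarz) (hBK : SpanningBKCap)
    {a C : ℝ}
    (hC : ∀ n : ℕ, 1 ≤ n →
      (∑ x ∈ box 3 n, ∑ y ∈ box 3 n,
          (bondPercolation (zdGraph 3) (criticalProbI 3)).real (openConnIn ↑(box 3 n) x y)) /
        ((box 3 n).card : ℝ) ^ 2 ≤ C * (n : ℝ) ^ (-a))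
    {s : ℝ} (hsa : s < a)
    (hu : ∃ᶠ n : ℕ in atTop, (n : ℝ) ^ (-s) ≤ (bondPercolation (zdGraph 3) (criticalProbI 3)).real
      {ω | ¬ ∃ x ∈ box 3 n, ∃ y ∈ innerBoundary (zdGraph 3) (box 3 (2 * n)),
        ω ∈ openConnIn ↑(box 3 (2 * n)) x y}) :
    _root_.PercolationContinuityZ3 := by
  refine Literature.Probability.Percolation.percolationContinuityZ3_iff.2 ?_
  have key : ∃ᶠ n : ℕ in atTop, (theta (zdGraph 3) (0 : Site 3) (criticalProbI 3)) ^ 2 ≤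
      64 * C * (2 : ℝ) ^ (-a) * (n : ℝ) ^ (-(a - s)) :=
    (hu.and_eventually (eventually_ge_atTop 1)).mono fun n h =>
      theta_sq_le_of_blocking hMCS hBK hC h.2 h.1
  have hlim : Tendsto (fun n : ℕ => 64 * C * (2 : ℝ) ^ (-a) * (n : ℝ) ^ (-(a - s))) atTop (𝓝 0) := by
    have h := ((tendsto_rpow_neg_atTop (sub_pos.2 hsa)).comp tendsto_natCast_atTop_atTop).const_mul
      (64 * C * (2 : ℝ) ^ (-a))
    rw [mul_zero] at h
    exact h
  have hsq : (theta (zdGraph 3) (0 : Site 3) (criticalProbI 3)) ^ 2 ≤ 0 := by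
    by_contra hpos
    push Not at hpos
    obtain ⟨n, h1, h2⟩ := (key.and_eventually (hlim.eventually (gt_mem_nhds hpos))).exists
    exact absurd (h1.trans_lt h2) (lt_irrefl _)
  exact pow_eq_zero_iff two_ne_zero |>.1 (le_antisymm hsq (sq_nonneg _))

/-- **`PolynomialAssembly` with the crux weakened to its FREQUENTLY form**:
`MeanCauchySchwarz → SpanningBKCap → FreeBoxPowerSaving → (∀ s > 0, ∃ᶠ n, n^{-s} ≤ u_n) → θ(p_c(ℤ³)) = 0`
(take `s := a/2 < a`). The filed crux `SubpolynomialBlocking` (`∀ s > 0, ∀ᶠ n, …`) trivially implies the hypothesis used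
here (`Eventually.frequently`), so this theorem contains `polynomialAssembly_proof` (item 4458). -/
theorem polynomialAssembly_frequently :
    MeanCauchySchwarz → SpanningBKCap → FreeBoxPowerSaving →
      (∀ s : ℝ, 0 < s → ∃ᶠ n : ℕ in atTop, (n : ℝ) ^ (-s) ≤
        (bondPercolation (zdGraph 3) (criticalProbI 3)).real
          {ω | ¬ ∃ x ∈ box 3 n, ∃ y ∈ innerBoundary (zdGraph 3) (box 3 (2 * n)),
            ω ∈ openConnIn ↑(box 3 (2 * n)) x y}) →
      _root_.PercolationContinuityZ3 := by
  intro hMCS hBK hFPS hfreq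
  unfold FreeBoxPowerSaving at hFPS
  obtain ⟨a, C, ha, hC⟩ := hFPS
  exact percolationContinuityZ3_of_frequently_blocking hMCS hBK hC (half_lt_self ha) (hfreq (a / 2) (half_pos ha))

end Summit.CriticalPhenomena.PercolationContinuityZ3.Theorems.SubpolynomialBlocking

end
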